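/-
Copyright (c) 2026 the pub-hodgecm-mathlib formalisation cell (harness21).  Prover seat hodgecm-mathlib-R90-C131-p02 (g2) = (TJ6) PEN on the S4 valve (dealer K2E2-plan (g8), S4-R59 (4) ∕
S4-R63 ∕ S4-R67 ∕ S4-R80), road (J̃♭) FILE (TJ6) «HERBRAND WINDOW», part 3d: THE COMPOSITION — the `h♮` letter of ★ `twistedTubeJacobian_of_local` VERBATIM.
Crux H413 `stmt-HodgeConjecture-24833`, lane `--supports … --as helper` (count-neutral).  THEOREMS ONLY (no `def`, no `instance`, no notation, no named-fact hypothesis, no `sorry`).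
-/
import Summits.HodgeConjecture.HodgeConjecture.Theorems.R90S4TwistedHerbrandWindow          -- (TJ6) FILE 3a (this seat): `herbrandWindow_index` (brings parts 1, 2a–2c)
import Summits.HodgeConjecture.HodgeConjecture.Theorems.R90S4TwistedHerbrandWindowData      -- ★ (TJ6) FILE 3c p865159 (R90-C131-p04 (g3)): `exists_herbrandWindowData`, `isOpen_NW`, `isOpen_cW_of_relIndex_ne_zero`
import Summits.HodgeConjecture.HodgeConjecture.Theorems.R90S4TwistedHerbrandWindowMeasure   -- ★ (TJ6) FILE 3b p865049 (K2E3-p03 (g10)): `herbrandWindow_of_index`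
import HarnessLib

/-!
# R90-TF · S4 (Ch. 13.1–2) · road (J̃♭) «TWISTED TUBE JACOBIAN», FILE (TJ6) «HERBRAND WINDOW», part 3d: THE `h♮` LETTER

Cell `hodgecm-mathlib`, crux H413 (`stmt-HodgeConjecture-24833`, lane `--supports … --as helper`), route of record `HCCMUnconditional` (no route verbs;
count-neutral).  Programme R90-TF, section S4 = [Rogawski1990] Ch. 13.1–13.2 (twisted Weyl integration formula, §12.5 p. 186); seat R90-C131-p02 (g2) =
(TJ6) pen; ORDER = S4 dealer K2E2-plan (g8) S4-R59 (4), spec of record S4-R63 = the binder `h♮` of ★ p864907 `twistedTubeJacobian_of_local` (K2E3-p03 (g10)).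

THE COMPOSITION of the four (TJ6) pieces: ★ FILE 3c `exists_herbrandWindowData` (the four window-subgroup families `K_W`, `cW`, `F_W`, `NW` with their
membership letters; `isOpen_NW` by the open mapping theorem; `isOpen_cW_of_relIndex_ne_zero`) + FILE 3a `herbrandWindow_index` (`[K_W : cW] = [F_W : NW] ≠ 0`,
the Herbrand quotient `h(⟨ε⟩, W_j) = 1` of the Cayley window through ★ parts 1, 2a–2c) + ★ FILE 3b `herbrandWindow_of_index` (index identity + pin ⇒ Haar form)
⇒ **`twistedHerbrandWindow`**: for every `j ≥ j₀` (any `j₀`),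
**`ρ(val⁻¹((w ↦ w·ε(w)⁻¹) '' W_j)) · τ′(val⁻¹(val '' W_j)) = ρ(val⁻¹ W_j) · tP(φ '' W_j)`** — the `h♮` letter, token for token.

LETTERS (all dischargeable at the datum `A = Cent_{G̃_v}(γ₀)`, `P′ = T′`, `φ = N`, the model chart of ★ `exists_glChart`, `𝔞 = Cent_{M₃(L_w)}(γ₀)`, `E = τ`,
`θ` anti-fixed): (TJ5-abs) `hP'A hAc hεA hεc hφc hφs`, windows `W hWo hWc hWε` + the chart membership letter `hW : a ∈ W j ↔ ∃ X ≤ α^(j+1), c X = a`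
(★ p864964 `exists_chartWindowSubgroups` at `V = M_m(K)`), involutivity `hεε`, the fixed-group letter `hP'ε : a ∈ P′ ↔ ε a = a`, THE PIN `e : P ≃* ↥P′`,
`he`, `hφe : e(φ w) = w·ε(w)`, `hpin : tP.map e = τ′`, the matrix chart `ρG hρinj c hc` (`ρG (c X) = cayley X` on `X ≤ α`), `𝔞 h𝔞c h𝔞i h𝔞cl h𝔞`, the slot map
`E hEm hE1 hEc hE hε` (`ρG(ε(c X))⁻¹ = cayley (E X)`), the anti-fixed scalar `hθ0 hθ1 hEθ`, `h2 : (2 : K) ≠ 0`, `hα hα1`.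

HONEST LABEL: HC_CM is proved only modulo the 7 printed citations (2 remaining named inputs: hLiu418 = `stmt-HodgeConjecture-24832`, h413 =
`stmt-HodgeConjecture-24833`) until rung 0 closes; this file pays the `h♮` ROW of the (J̃♭) socket at the datum modulo its letters — it closes no socket by itself
(REL ≠ ★ ≠ BUILT; count-neutral).

## References
* [Serre1979] J.-P. Serre, *Local Fields*, GTM 67 (1979), VIII §4 (Herbrand quotient). Context locator.
* [Rogawski1990] J. D. Rogawski, *Automorphic Representations of Unitary Groups in Three Variables*, Ann. of Math. Stud. 123 (1990), §3.11 Prop. 3.11.1, §12.5 p. 186. Context locator.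
* [DeitmarEchterhoff2014] A. Deitmar, S. Echterhoff, *Principles of Harmonic Analysis*, 2nd ed. (2014), §1.5 (Haar measure, quotient integral formula). Context locator.
-/

set_option autoImplicit false
-- the mandated namespace repeats the single-problem summit's segment (`HodgeConjecture.HodgeConjecture`)
set_option linter.dupNamespace false

open Set MeasureTheory Matrix ValuativeRel
open Literature.NumberTheory.Automorphic Literature.NumberTheory.Weil1982.UnitaryFinTopForm
open scoped MatrixGroups

namespace Summit.HodgeConjecture.HodgeConjecture.R90.S4

section Letter

variable {G : Type*} [Group G] [TopologicalSpace G] [IsTopologicalGroup G] [MeasurableSpace G] [BorelSpace G]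
  [LocallyCompactSpace G] [SecondCountableTopology G] [T2Space G]
  (ε : G →* G) (A P' : Subgroup G) {P : Type*} [Group P] [TopologicalSpace P] [MeasurableSpace P] [BorelSpace P] [T1Space P] (φ : ↥A →* P)
  {K : Type*} [Field K] [ValuativeRel K] [TopologicalSpace K] [IsNonarchimedeanLocalField K] {m : Type*} [Fintype m] [DecidableEq m]

/-- **THE HERBRAND WINDOW LETTER `h♮`** of ★ `twistedTubeJacobian_of_local` (S4-R63), PROVED at the Cayley-chart frame of the model: for every `j ≥ j₀`,
**`ρ(val⁻¹((w ↦ w·ε(w)⁻¹) '' W_j)) · τ′(val⁻¹(val '' W_j)) = ρ(val⁻¹ W_j) · tP(φ '' W_j)`** — i.e. `ρ(c(W_j))·τ′(T′ ∩ W_j) = ρ(T̃ᴺ ∩ W_j)·tT(N(W_j))`, the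
Herbrand quotient `h(⟨ε⟩, W_j) = 1` of the compact open window in Haar form.  Composition of ★ FILE 3c `exists_herbrandWindowData` ∕ `isOpen_NW` ∕
`isOpen_cW_of_relIndex_ne_zero` (R90-C131-p04), FILE 3a `herbrandWindow_index` (this seat: `[K_W : cW] = [F_W : NW] ≠ 0` via ★ parts 1, 2a–2c: involution index
identity, velocity law of the Cayley chart, ψ-Newton, doubling index through the chart, θ-transport), ★ FILE 3b `herbrandWindow_of_index` (K2E3-p03: Haar mass =
index × mass, the pin `tP.map e = τ′`).  [cite: Serre1979, VIII §4 Props. 7–8] [cite: Rogawski1990, §3.11 Prop. 3.11.1, §12.5 p. 186] [cite: DeitmarEchterhoff2014, §1.5] -/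
theorem twistedHerbrandWindow [hA : IsClosed (A : Set G)] [hP' : IsClosed (P' : Set G)]
    (hP'A : P' ≤ A) (hAc : ∀ x ∈ A, ∀ y ∈ A, x * y = y * x) (hεA : ∀ x ∈ A, ε x ∈ A) (hεε : ∀ x ∈ A, ε (ε x) = x) (hεc : Continuous ε)
    (hP'ε : ∀ a ∈ A, a ∈ P' ↔ ε a = a) (hφc : Continuous φ) (hφs : Function.Surjective φ)
    (e : P ≃* ↥P') (he : Continuous e) (hφe : ∀ w : ↥A, ((e (φ w) : ↥P') : G) = (w : G) * ε w)
    (ρ : Measure ↥φ.ker) [ρ.IsMulLeftInvariant] (τ' : Measure ↥P') [τ'.IsMulLeftInvariant] (tP : Measure P) (hpin : tP.map e = τ')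
    (W : ℕ → Subgroup ↥A) (hWo : ∀ j, IsOpen (W j : Set ↥A)) (hWc : ∀ j, IsCompact (W j : Set ↥A))
    (hWε : ∀ (j : ℕ) (w : ↥A), w ∈ W j → (⟨ε w, hεA w w.2⟩ : ↥A) ∈ W j)
    (ρG : G →* GL m K) (hρinj : Function.Injective ρG) (c : Matrix m m K → G) {α : ValueGroupWithZero K} (hα : α ≠ 0) (hα1 : α < 1) (h2 : (2 : K) ≠ 0)
    (hc : ∀ X, ValBound α X → ((ρG (c X) : GL m K) : Matrix m m K) = cayley X)
    (hW : ∀ (j : ℕ) (a : ↥A), a ∈ W j ↔ ∃ X, ValBound (α ^ (j + 1)) X ∧ c X = a)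
    (𝔞 : Subalgebra K (Matrix m m K)) (h𝔞c : ∀ X ∈ 𝔞, ∀ Y ∈ 𝔞, X * Y = Y * X) (h𝔞i : ∀ X ∈ 𝔞, IsUnit X.det → X⁻¹ ∈ 𝔞)
    (h𝔞cl : IsClosed (𝔞 : Set (Matrix m m K))) (h𝔞 : ∀ X, ValBound α X → (c X ∈ A ↔ X ∈ 𝔞))
    (E : Matrix m m K →+ Matrix m m K) (hEm : ∀ X Y, E (X * Y) = E Y * E X) (hE1 : E 1 = 1) (hEc : Continuous E)
    (hE : ∀ (γ : ValueGroupWithZero K) (X : Matrix m m K), ValBound γ X → ValBound γ (E X))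
    (hε : ∀ X, ValBound α X → (((ρG (ε (c X)))⁻¹ : GL m K) : Matrix m m K) = cayley (E X))
    {θ : K} (hθ0 : θ ≠ 0) (hθ1 : valuation K θ ≤ 1) (hEθ : ∀ X, E (θ • X) = -(θ • E X)) {j₀ : ℕ} :
    ∀ j, j₀ ≤ j →
      ρ ((Subtype.val : ↥φ.ker → ↥A) ⁻¹' ((fun w : ↥A => w * (⟨ε w, hεA w w.2⟩ : ↥A)⁻¹) '' (W j : Set ↥A))) *
          τ' ((Subtype.val : ↥P' → G) ⁻¹' (Subtype.val '' (W j : Set ↥A))) =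
        ρ ((Subtype.val : ↥φ.ker → ↥A) ⁻¹' (W j : Set ↥A)) * tP (φ '' (W j)) := by
  -- `φ` is `ε`-invariant on `A` (through the pin, `ε ∘ ε = id`, `A` abelian)
  have hφε : ∀ w : ↥A, φ ⟨ε w, hεA w w.2⟩ = φ w := by
    intro w
    apply e.injective
    apply Subtype.ext
    rw [hφe, hφe]
    show ε (w : G) * ε (ε (w : G)) = (w : G) * ε (w : G)
    rw [hεε _ w.2, hAc _ (hεA _ w.2) _ w.2]
  -- ★ FILE 3c: the four window-subgroup families
  obtain ⟨KW, cW, FW, NW, hKW, hcW, hFW, hNW⟩ := exists_herbrandWindowData ε A P' φ hP'A hAc hεA hφε e hφe W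
  -- FILE 3a: the index identity and its finiteness
  have hidx := fun j => herbrandWindow_index ε A P' φ ρG hρinj c hα hα1 h2 hc 𝔞 h𝔞c h𝔞i h𝔞cl h𝔞 E hEm hE1 hEc hE hε hθ0 hθ1 hEθ hAc hεA hεε hP'ε
    e hφe W hW KW cW FW NW hKW hcW hFW hNW j
  -- ★ FILE 3b
  exact herbrandWindow_of_index ε A P' φ hP'A hεA hφc ρ τ' tP W hWo hWc hWε KW cW FW NW hKW hcW hFW hNW
    (fun j _ => isOpen_cW_of_relIndex_ne_zero ε A φ hεA hεc hφc W hWo hWc hWε KW cW hKW hcW j (hidx j).2)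
    (fun j _ => isOpen_NW ε A P' φ hφc hφs e he hφe W hWo NW hNW j)
    (fun j _ => (hidx j).1) e he hφe hpin

end Letter

end Summit.HodgeConjecture.HodgeConjecture.R90.S4
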